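import Summits.Ventures.WeilGRH.ZetaWindowPhaseBlind
import Summits.Ventures.WeilGRH.FlatSumUnconditional
import Summits.Ventures.WeilGRH.ZetaGramAtoms
import HarnessLib

/-!
# rh-explicit (venture WeilGRH): RH ⟹ `ord_{½+iγ} ζ ≤ (½ + 2.29/log log γ)·log γ/log log γ` FOR EVERY `|γ| ≥ 16`
  (and `½ + 2.08/log log γ` up to `γ = e^{100}`) — Goldston–Gonek's constant `½` with an EXPLICIT lower-order term,
  from ONE window read phase-blind; standard axioms

Cell `rh-explicit`, WEIL TRACK (structure seat weil-3, gen11 → gen12).  The phase-blind budget of `ZetaWindowPhaseBlind`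
(`2a·μ{τ} ≤ pole + log(|τ|/2π) + 2/τ² + (2/|τ|+2/τ²)/a + 2S(a)` for every Weil measure of the rung `a`) with the
flat prime sum bounded through a Chebyshev estimate ON THE WINDOW (`FlatSumUnconditional.flatSum_le_of_psi_le_on`:
`ψ(t) ≤ c·t` for `t ≤ e^{2a}` ⟹ `S(a) ≤ c(2(eᵃ − 1)/a − 1)`), at the window `a = log log|τ|` (`eᵃ = log|τ|`,
horizon `(log|τ|)²`):

* `two_mul_mul_zetaAtom_le_chebyshev` (RH-free, `c` a hypothesis): `2a·μ{τ} ≤ 4(sinh²(a/2)+sin²(aτ))/(a(¼+τ²)) +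
  log(|τ|/2π) + 2/τ² + (2/|τ|+2/τ²)/a + 2c(2(eᵃ−1)/a − 1)`;
* `loglogBudget_le` (real analysis, `c ≥ 1`): at `a = log log|τ|`, `|τ| ≥ 16` the right side is
  `≤ log|τ| + 4c·log|τ|/log log|τ|` (`sinh²(a/2) ≤ eᵃ/4`, `log 2π ≥ 1.8378`);
* **`zetaZeroOrder_le_goldstonGonek_explicit_of_riemannHypothesis`**: RH ⟹ for every `|γ| ≥ 16`,

    `ord_{s=½+iγ} ζ(s) ≤ (½ + 2.29/log log|γ|) · log|γ|/log log|γ|`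

  — the ONLY arithmetic input is the tree's UNCONDITIONAL kernel-checked `ψ(x) ≤ 1.1422x`
  (`FlatSumUnconditional.psi_le_mul_unconditional`: `lcm` computation below `10⁴` + Sylvester); RH enters only
  through the positivity of the window (`ν_ζ` represents Weil's form);
* **`zetaZeroOrder_le_goldstonGonek_explicit_of_riemannHypothesis_of_log_le`**: for `16 ≤ |γ|`, `log|γ| ≤ 100`
  (horizon `(log|γ|)² ≤ 10⁴`, only `ψ(t) ≤ 1.04t` from the kernel computation enters):

    `ord_{s=½+iγ} ζ(s) ≤ (½ + 2.08/log log|γ|) · log|γ|/log log|γ|`.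

(gen11's version used `ψ ≤ 1.04t` for all `t` under RH via `SchoenfeldPsiTheta.psi_le_mul`, whose axiom closure
contains the `native_decide` certificates of the first `2000` zeros; the present file has axioms
`{propext, Classical.choice, Quot.sound}`.  The Dirichlet twin under GRH(χ) alone is `CharCentralOrderExplicit`.)

CALIBRATION (weil-grh-5's A52 table).  Goldston–Gonek 2007 Cor 1: `(½ + o(1))log γ/log log γ` (not explicit);
Simonič 2022 Cor 1 via `|S(t)| ≤ 0.96 log t/log log t`: `1.92·log γ/log log γ` at every `γ ≥ 2π`.  This file:
`½ + 2.08/log log γ = 1.86 / 1.58 / 1.29 / 1.13` (`γ ≤ e^{100}`) and `½ + 2.29/log log γ = 2.00 / 1.68 / 1.37 / 1.19`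
(all `γ`) at `γ = 10² / 10³ / 10⁶ / 10¹²` — below `1.92` from `γ ≥ 100` (resp. `γ ≥ 170`) on, and `→ ½`.

No definitions, no named facts; RH is a hypothesis exactly where stated; standard axioms.
-/

set_option autoImplicit false

noncomputable section

open Complex Filter Set MeasureTheory
open scoped Real Topology Chebyshev ArithmeticFunction.vonMangoldt

namespace Summit.Ventures.WeilGRH

open Literature.NumberTheory.LFunctions
open Literature.NumberTheory.LFunctions.WeilBochner (zetaZeroHeightMeasure)

variable {a : ℝ}

/-- **The window budget with a Chebyshev bound for the primes below the horizon** (RH-free; `ψ(t) ≤ c·t` for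
`t ≤ e^{2a}` a hypothesis): for `a > 0`,
`|τ| ≥ 2` and every positive measure `μ` representing Weil's form on the tests of `[-a, a]`,
`2a·μ{τ} ≤ 4(sinh²(a/2) + sin²(aτ))/(a(¼+τ²)) + log(|τ|/(2π)) + 2/τ² + (2/|τ| + 2/τ²)/a + 2c(2(eᵃ − 1)/a − 1)`. -/
theorem two_mul_mul_zetaAtom_le_chebyshev {c : ℝ} (ha : 0 < a)
    (hψ : ∀ t : ℝ, 0 ≤ t → t ≤ Real.exp (2 * a) → ψ t ≤ c * t)
    {μ : Measure ℝ}
    (hμ : ∀ g : ℝ → ℂ, IsWeilTest g → tsupport g ⊆ Icc (-a) a →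
      Integrable (fun t : ℝ ↦ ‖weilMellin g (1 / 2 + t * I)‖ ^ 2) μ ∧
        weilQuadratic g = ((∫ t, ‖weilMellin g (1 / 2 + t * I)‖ ^ 2 ∂μ : ℝ) : ℂ)) {τ : ℝ} (hτ : 2 ≤ |τ|) :
    2 * a * μ.real {τ} ≤
      4 * (Real.sinh (a / 2) ^ 2 + Real.sin (τ * a) ^ 2) / (a * (1 / 4 + τ ^ 2)) +
        (Real.log (|τ| / (2 * π)) + 2 / τ ^ 2 + (2 / |τ| + 2 / τ ^ 2) / a) +
        2 * (c * (2 * (Real.exp a - 1) / a - 1)) := by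
  have h := two_mul_mul_zetaAtom_le_phaseBlind ha hμ hτ
  have hS := flatSum_le_of_psi_le_on ha hψ
  linarith

/-- `sinh²(a/2) ≤ eᵃ/4` for `a ≥ 0`. -/
theorem sinh_sq_half_le (ha : 0 ≤ a) : Real.sinh (a / 2) ^ 2 ≤ Real.exp a / 4 := by
  have h1 : Real.sinh (a / 2) ≤ Real.exp (a / 2) / 2 := by
    rw [Real.sinh_eq]; linarith [Real.exp_pos (-(a / 2))]
  have h0 : 0 ≤ Real.sinh (a / 2) := Real.sinh_nonneg_iff.2 (by linarith)
  have h2 : Real.exp (a / 2) ^ 2 = Real.exp a := by rw [sq, ← Real.exp_add]; ring_nf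
  calc Real.sinh (a / 2) ^ 2 ≤ (Real.exp (a / 2) / 2) ^ 2 := pow_le_pow_left₀ h0 h1 2
    _ = Real.exp a / 4 := by rw [div_pow, h2]; norm_num

/-- **The budget at the window `a = log log|τ|`** (real analysis): for `|τ| ≥ 16`, `c ≥ 1`, with `ℓ = log|τ|`,
`a = log ℓ`,

  `4(sinh²(a/2)+sin²(aτ))/(a(¼+τ²)) + log(|τ|/2π) + 2/τ² + (2/|τ|+2/τ²)/a + 2c(2(eᵃ−1)/a − 1) ≤ ℓ + 4c·ℓ/a`. -/
theorem loglogBudget_le {τ : ℝ} (hτ : 16 ≤ |τ|) {c : ℝ} (hc : 1 ≤ c) :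
    4 * (Real.sinh (Real.log (Real.log |τ|) / 2) ^ 2 + Real.sin (τ * Real.log (Real.log |τ|)) ^ 2) /
          (Real.log (Real.log |τ|) * (1 / 4 + τ ^ 2)) +
        (Real.log (|τ| / (2 * π)) + 2 / τ ^ 2 + (2 / |τ| + 2 / τ ^ 2) / Real.log (Real.log |τ|)) +
        2 * (c * (2 * (Real.exp (Real.log (Real.log |τ|)) - 1) / Real.log (Real.log |τ|) - 1)) ≤
      Real.log |τ| + 4 * c * Real.log |τ| / Real.log (Real.log |τ|) := by
  set u : ℝ := |τ| with hu
  set ℓ : ℝ := Real.log u with hℓ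
  set b : ℝ := Real.log ℓ with hb
  have hu0 : 0 < u := by linarith
  -- `ℓ ≥ log 16 > e^1.01`, so `b > 1.01 > 0`; and `ℓ ≤ u`
  have hl2 := Real.log_two_gt_d9
  have hℓ16 : 2.77 ≤ ℓ := by
    have h16 : Real.log 16 = 4 * Real.log 2 := by
      rw [show (16 : ℝ) = 2 ^ 4 by norm_num, Real.log_pow]; norm_num
    have := Real.log_le_log (by norm_num) hτ
    rw [h16] at this
    linarith
  have hℓ0 : 0 < ℓ := by linarith
  have hb0 : 0 < b := by rw [hb]; exact Real.log_pos (by linarith)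
  have hb1 : 1 ≤ b := by
    rw [hb, ← Real.log_exp 1]
    refine Real.log_le_log (Real.exp_pos 1) ?_
    have := Real.exp_one_lt_d9
    linarith
  have hℓu : ℓ ≤ u := by rw [hℓ]; exact (Real.log_le_sub_one_of_pos hu0).trans (by linarith)
  have hexp : Real.exp b = ℓ := by rw [hb, Real.exp_log hℓ0]
  rw [hexp]
  -- the pole term: `4(sinh²(b/2) + sin²) / (b(¼+τ²)) ≤ (ℓ + 4)/(b τ²) ≤ (u + 4)/(b u²)`
  have hsinh := sinh_sq_half_le hb0.le
  rw [hexp] at hsinh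
  have hsin := Real.sin_sq_le_one (τ * b)
  have hsq : τ ^ 2 = u ^ 2 := (sq_abs τ).symm
  rw [hsq]
  have hP : 4 * (Real.sinh (b / 2) ^ 2 + Real.sin (τ * b) ^ 2) / (b * (1 / 4 + u ^ 2)) ≤ (u + 4) / (b * u ^ 2) := by
    rw [div_le_div_iff₀ (by positivity) (by positivity)]
    have h1 : 4 * (Real.sinh (b / 2) ^ 2 + Real.sin (τ * b) ^ 2) ≤ ℓ + 4 := by nlinarith
    have h2 : 0 ≤ 4 * (Real.sinh (b / 2) ^ 2 + Real.sin (τ * b) ^ 2) := by positivity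
    calc 4 * (Real.sinh (b / 2) ^ 2 + Real.sin (τ * b) ^ 2) * (b * u ^ 2)
        ≤ (ℓ + 4) * (b * u ^ 2) := mul_le_mul_of_nonneg_right h1 (by positivity)
      _ ≤ (u + 4) * (b * u ^ 2) := by gcongr
      _ ≤ (u + 4) * (b * (1 / 4 + u ^ 2)) := by nlinarith
  -- `log(u/2π) = ℓ − log 2 − log π ≤ ℓ − 1.8378`
  obtain ⟨hlpi, -⟩ := KadiriNumerics.log_pi_bounds
  have hlog : Real.log (u / (2 * π)) = ℓ - Real.log 2 - Real.log π := by
    rw [Real.log_div hu0.ne' (by positivity), Real.log_mul two_ne_zero Real.pi_pos.ne', hℓ]; ring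
  rw [hlog]
  -- the small terms: `(u+4)/(b u²) + 2/u² + (2/u + 2/u²)/b ≤ 0.3/b + 0.01` for `u ≥ 16`, `b ≥ 1`
  have hu2 : 0 < u ^ 2 := by positivity
  have hq : u + 4 ≤ 0.08 * u ^ 2 := by nlinarith [mul_le_mul hτ hτ (by norm_num) hu0.le]
  have hA : (u + 4) / (b * u ^ 2) ≤ 0.08 / b :=
    calc (u + 4) / (b * u ^ 2) ≤ 0.08 * u ^ 2 / (b * u ^ 2) := div_le_div_of_nonneg_right hq (by positivity)
      _ = 0.08 / b := by field_simp
  have hB : 2 / u ^ 2 ≤ 0.01 := by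
    rw [div_le_iff₀ hu2]; nlinarith [mul_le_mul hτ hτ (by norm_num) hu0.le]
  have hC : (2 / u + 2 / u ^ 2) / b ≤ 0.14 / b := by
    refine div_le_div_of_nonneg_right ?_ hb0.le
    have h1 : 2 / u ≤ 2 / 16 := div_le_div_of_nonneg_left (by norm_num) (by norm_num) hτ
    have h2 : 2 / u ^ 2 ≤ 2 / 16 ^ 2 := div_le_div_of_nonneg_left (by norm_num) (by norm_num)
      (pow_le_pow_left₀ (by norm_num) hτ 2)
    linarith
  -- `2·c·(2(ℓ−1)/b − 1) = 4c ℓ/b − 4c/b − 2c`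
  have hD : 2 * (c * (2 * (ℓ - 1) / b - 1)) = 4 * c * ℓ / b - 4 * c / b - 2 * c := by
    field_simp; ring
  rw [hD]
  have hE : 0.08 / b + 0.14 / b - 4 * c / b ≤ 0 := by
    rw [← add_div, ← sub_div]; exact div_nonpos_of_nonpos_of_nonneg (by linarith) hb0.le
  linarith

/-- Under RH, `ν_ζ` represents Weil's form on the tests of every window. -/
private theorem zetaZeroHeightMeasure_represents' (hRH : RiemannHypothesis) (a : ℝ) :
    ∀ g : ℝ → ℂ, IsWeilTest g → tsupport g ⊆ Icc (-a) a →
      Integrable (fun t : ℝ ↦ ‖weilMellin g (1 / 2 + t * I)‖ ^ 2) zetaZeroHeightMeasure ∧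
        weilQuadratic g = ((∫ t, ‖weilMellin g (1 / 2 + t * I)‖ ^ 2 ∂zetaZeroHeightMeasure : ℝ) : ℂ) :=
  fun _ hg _ ↦ WeilBochner.weilQuadratic_eq_integral_of_riemannHypothesis hRH hg

/-- The route, parametric in the Chebyshev constant: RH, `|γ| ≥ 16`, `c ≥ 1`, `ψ(t) ≤ c·t` for
`0 ≤ t ≤ (log|γ|)²` ⟹ `ord_{s=½+iγ} ζ(s) ≤ (½ + 2c/log log|γ|)·log|γ|/log log|γ|`. -/
theorem zetaZeroOrder_le_of_psi_le_of_riemannHypothesis (hRH : RiemannHypothesis) {γ : ℝ} (hγ : 16 ≤ |γ|)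
    {c : ℝ} (hc : 1 ≤ c) (hψ : ∀ t : ℝ, 0 ≤ t → t ≤ Real.log |γ| ^ 2 → ψ t ≤ c * t) :
    ((riemannZetaZeroOrder (1 / 2 + γ * I)).toNat : ℝ) ≤
      (1 / 2 + 2 * c / Real.log (Real.log |γ|)) * (Real.log |γ| / Real.log (Real.log |γ|)) := by
  set b : ℝ := Real.log (Real.log |γ|) with hb
  have hl2 := Real.log_two_gt_d9
  have hℓ : 2.77 ≤ Real.log |γ| := by
    have h16 : Real.log 16 = 4 * Real.log 2 := by
      rw [show (16 : ℝ) = 2 ^ 4 by norm_num, Real.log_pow]; norm_num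
    have := Real.log_le_log (by norm_num) hγ
    rw [h16] at this
    linarith
  have hℓ0 : 0 < Real.log |γ| := by linarith
  have hb0 : 0 < b := by rw [hb]; exact Real.log_pos (by linarith)
  have hexp : Real.exp (2 * b) = Real.log |γ| ^ 2 := by
    rw [hb, mul_comm, Real.exp_mul, Real.exp_log hℓ0]; norm_cast
  have hψ' : ∀ t : ℝ, 0 ≤ t → t ≤ Real.exp (2 * b) → ψ t ≤ c * t := fun t ht htb ↦
    hψ t ht (by rwa [hexp] at htb)
  have h := two_mul_mul_zetaAtom_le_chebyshev hb0 hψ' (zetaZeroHeightMeasure_represents' hRH b) (τ := γ)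
    (by linarith)
  rw [measureReal_def, zetaZeroHeightMeasure_singleton_of_riemannHypothesis hRH, ENNReal.toReal_natCast] at h
  have hB := loglogBudget_le hγ hc
  -- `2b·m ≤ ℓ + 4c ℓ/b` ⟹ `m ≤ (½ + 2c/b)(ℓ/b)`
  have hm : 2 * b * ((riemannZetaZeroOrder (1 / 2 + γ * I)).toNat : ℝ) ≤
      Real.log |γ| + 4 * c * Real.log |γ| / b := h.trans hB
  rw [show (1 / 2 + 2 * c / b) * (Real.log |γ| / b) = (Real.log |γ| + 4 * c * Real.log |γ| / b) / (2 * b) by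
    field_simp; ring]
  rw [le_div_iff₀ (by positivity)]
  linarith

/-- **RH ⟹ AN EXPLICIT GOLDSTON–GONEK BOUND AT EVERY HEIGHT `|γ| ≥ 16`**:

  `ord_{s=½+iγ} ζ(s) ≤ (½ + 2.29/log log|γ|) · log|γ| / log log|γ|`

— one window of half-length `log log|γ|`, read phase-blind, with the primes below the horizon `(log|γ|)²` bounded
through the tree's UNCONDITIONAL kernel-checked `ψ(t) ≤ 1.1422t` (`psi_le_mul_unconditional`); standard axioms.
The constant `½` is Goldston–Gonek's; the lower-order term is explicit, so the bound is below Simonič's explicit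
`1.92·log γ/log log γ` for every `γ ≥ 170`. -/
theorem zetaZeroOrder_le_goldstonGonek_explicit_of_riemannHypothesis (hRH : RiemannHypothesis) {γ : ℝ} (hγ : 16 ≤ |γ|) :
    ((riemannZetaZeroOrder (1 / 2 + γ * I)).toNat : ℝ) ≤
      (1 / 2 + 2.29 / Real.log (Real.log |γ|)) * (Real.log |γ| / Real.log (Real.log |γ|)) := by
  have h := zetaZeroOrder_le_of_psi_le_of_riemannHypothesis hRH hγ (c := 1.1422) (by norm_num)
    (fun t ht _ ↦ psi_le_mul_unconditional ht)
  have hl2 := Real.log_two_gt_d9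
  have hℓ : 2.77 ≤ Real.log |γ| := by
    have h16 : Real.log 16 = 4 * Real.log 2 := by
      rw [show (16 : ℝ) = 2 ^ 4 by norm_num, Real.log_pow]; norm_num
    have := Real.log_le_log (by norm_num) hγ
    rw [h16] at this
    linarith
  have hb0 : 0 < Real.log (Real.log |γ|) := Real.log_pos (by linarith)
  have hℓb : 0 ≤ Real.log |γ| / Real.log (Real.log |γ|) := by positivity
  refine h.trans (mul_le_mul_of_nonneg_right ?_ hℓb)
  gcongr; norm_num

/-- **… AND WITH THE PRINTED-SIZE CONSTANT UP TO `γ = e^{100}`**: RH, `16 ≤ |γ|`, `log|γ| ≤ 100` ⟹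

  `ord_{s=½+iγ} ζ(s) ≤ (½ + 2.08/log log|γ|) · log|γ| / log log|γ|`

(horizon `(log|γ|)² ≤ 10⁴`: only the kernel computation `ψ(t) ≤ 1.04t`, `t ≤ 10⁴`, enters); below Simonič's
`1.92·log γ/log log γ` for every `γ ≥ 100`. -/
theorem zetaZeroOrder_le_goldstonGonek_explicit_of_riemannHypothesis_of_log_le (hRH : RiemannHypothesis) {γ : ℝ}
    (hγ : 16 ≤ |γ|) (hγ' : Real.log |γ| ≤ 100) :
    ((riemannZetaZeroOrder (1 / 2 + γ * I)).toNat : ℝ) ≤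
      (1 / 2 + 2.08 / Real.log (Real.log |γ|)) * (Real.log |γ| / Real.log (Real.log |γ|)) := by
  have hℓ0 : 0 ≤ Real.log |γ| := Real.log_nonneg (by linarith)
  have h := zetaZeroOrder_le_of_psi_le_of_riemannHypothesis hRH hγ (c := 1.04) (by norm_num) (fun t ht htq ↦
    SchoenfeldBound.psi_le_of_le_ten_thousand ht (htq.trans (by nlinarith)))
  norm_num at h ⊢
  exact h

end Summit.Ventures.WeilGRH

end
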